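import Summits.Langlands.Langlands.Theses.DyadicOddResidue
import Summits.Langlands.Langlands.Theorems.DyadicOddResidueSectorComplementRigidityTransport
import Summits.Langlands.Langlands.Theorems.PhantomRMYoshidaPhantomRMJunctionGenericRigidity
import Summits.Langlands.Langlands.Theorems.PhantomRMYoshidaPhantomRMJunctionInvariantMeasureGLQuot
import Literature.NumberTheory.Automorphic.LocalLanglandsGLIndecomposable
import Literature.NumberTheory.GaloisRepresentations.HenniartGaloisSideCharacterisation
import HarnessLib

/-!
# SKELETON v3 — line `Sketch_18745_r1_k1` (idea `reciprocity-rigidity`) for the crux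
`DyadicOddResidue.SectorComplement` (item stmt-Langlands-18745), lead prover-line-stmt-Langlands-18745-c1-0
(continuation c1, cycle 2, 2026-08-17)

The crux is the route's JUNCTION `C := X → _root_.Langlands` (`X = OddRegularReciprocityQ`, inlined),
open-problem by construction (`Langlands ↔ X ∧ C`, landed by the disprover, p144479).  The line's lever is
R = RIGIDITY OF PINNED RECIPROCITY DATA: two `ReciprocityData K` (pinned to THE local Artin maps by
`llc_isCanonical`, `llc_eps_isCanonical`) have the same `rec_n` on the local components of cuspidal
automorphic representations, whence `Langlands ↔ Langlands_∃` and `C ⟸ R ∧ (X → Langlands_∃)`.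

RESHAPE (cycle 2).  Cycle 1 (lead -0) landed rank-2 generic rigidity under a Bump 1997 hypothesis
(`recGL_two_eq_of_isGeneric_of_not_isSupercuspidal`, p150979) and left four sorries: the Bump fact (T1),
rank ≥ 3 generic rigidity (S5b), `localLanglands_gl` (S6, T0) and the junction S7.  Meanwhile generic
rigidity in EVERY rank was landed modulo four named facts of print by the lead of the homonymous frame
stmt-Langlands-13643 (`PhantomRMJunctionOfPieces.recGL_eq_of_isGeneric_of_namedFacts`, p157386), and its
measure-theoretic input (Fν) was DISCHARGED (`PhantomRMJunctionOfPieces.stub_exists_smulInvariantMeasure_glQuotUpperUnitriangular`,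
from p158762, Weil's theorem for `GL_m(F) ⊇ U_m(F)`).  This skeleton imports both: the Bump stub and S5b are
RETIRED (no longer on the path), and R is obtained from three named facts of print, each a registered
stub stated BY NAME at every non-archimedean local field:

* F1 `stub_localLanglands_gl` — `localLanglands_gl` (Harris–Taylor 2001 Thm A + Henniart 1993 Thm 1.1:
  existence of a six-clause correspondence and uniqueness on supercuspidal classes) — T0 debt, also the
  registered stub of the same name on stmt-Langlands-17925 / 13643;
* F2 `stub_localLanglands_gl_indecomposable` — `localLanglands_gl_indecomposable` (Henniart 2002 Thm 1.5 (i),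
  §2.7, §2.9; Zelevinsky 1980 Thm 9.7: supercuspidal ↔ irreducible parameter, indecomposable parameters are
  parameters of classes generic for every `ψ`) — T0 debt (contains existence);
* F3 `stub_henniart2002_thm17a` — `Henniart2002_isEquivalent_of_rootMultiplicity_eulerFactor_tprod_eq`
  (Henniart 2002 Thm 1.7 (a), Galois side) — being discharged on the chain of stmt-Langlands-17925
  (pole-order half landed p162414; reconstruction half = its stub `stub_isEquivalent_of_finrank_invariants_tprod_eq`).

Composition (sorry-free glue, this file):

  `SectorComplement_of : SectorComplement`
    ⟸ `sectorComplement_of_rigid_of_junction` (transfer, LANDED p145687)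
    ⟸ `recRigidityOnLocalComponents_of_stubs` (R on local components of cuspidal `π`: generic classes by
       `recGL_eq_of_isGeneric_of_namedFacts` from F1 F2 F3 + the discharged (Fν); local components are
       generic, `CuspidalAutomorphicRepData.exists_isGeneric_of_hasLocalComponentAt`, Shalika 1974)
    and the junction stub S7 `stub_junctionExists : X → Langlands_∃` (OPEN CONJECTURE — the summit off the
       sector in `∃ 𝓡` form; registered, never delegated; in the tree it is implied by the EXISTING items
       stmt-Langlands-17925 ∧ 13622 ∧ 19093, `PhantomRMJunctionOfR.langlands_of_reciprocityUpToIrreducibilityR_text_of_JS`).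

Registered stubs after this reshape: F1, F2, F3, S7 (4 ≤ 7).  No definitions.
-/

noncomputable section

set_option linter.dupNamespace false

open scoped MatrixGroups NumberField
open Module NumberField IsDedekindDomain Filter MeasureTheory
open Literature.NumberTheory.Automorphic Literature.NumberTheory.GaloisRepresentations
open Summit.Langlands
open Summit.Langlands.Langlands.Theses.DyadicOddResidue

namespace Summit.Langlands.Langlands.Theorems.ReciprocityRigidity

/-! ## §1 The three named facts of print (registered stubs F1, F2, F3) -/

/-- **Stub F1 (T0 LITERATURE DEBT, never delegated): the local Langlands correspondence for `GL_n` with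
Henniart's uniqueness on supercuspidals, for every non-archimedean local field and normalising pair** —
the tree's named fact `localLanglands_gl` (Harris–Taylor 2001 Thm A; Henniart 2000 Thm 1.2; uniqueness
Henniart 1993 Thm 1.1). [cite: HarrisTaylorAMS2001, Thm. A] [cite: Henniarts1993, Thm 1.1] -/
theorem stub_localLanglands_gl :
    ∀ (F : Type) [Field F] [ValuativeRel F] [TopologicalSpace F] [IsNonarchimedeanLocalField F]
      (hmul : @IsFrobPow.mul F _ _ _ _) (huniq : @IsFrobPow.unique F _ _ _ _)
      (hn : absInertia_normal F) (hex : @exists_isFrobPow F _ _ _ _)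
      (hns : @WeilGroup.exists_subgroup_le_inertia_isOpen_of_continuous F _ _ _ _)
      (d : LocalArtinData F) (𝓔 : LocalEpsilonSystem F) (hd : 𝓔.artin F = d),
      localLanglands_gl F hmul huniq hn hex hns d 𝓔 hd := by
  sorry

/-- **Stub F2 (T0 LITERATURE DEBT, never delegated): THE correspondence matches supercuspidal classes with
irreducible parameters and hits every indecomposable parameter with a class generic for every `ψ`** — the
tree's named fact `localLanglands_gl_indecomposable` (Henniart 2002 Thm 1.5 (i), §2.7, §2.9; Zelevinsky
1980 Thm 9.7). [cite: HenniartBSMF2002, Thm. 1.5 (i), §2.7 and §2.9] [cite: Zelevinsky1980, Thm. 9.7] -/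
theorem stub_localLanglands_gl_indecomposable :
    ∀ (F : Type) [Field F] [ValuativeRel F] [TopologicalSpace F] [IsNonarchimedeanLocalField F]
      (hmul : @IsFrobPow.mul F _ _ _ _) (huniq : @IsFrobPow.unique F _ _ _ _)
      (hn : absInertia_normal F) (hex : @exists_isFrobPow F _ _ _ _)
      (hns : @WeilGroup.exists_subgroup_le_inertia_isOpen_of_continuous F _ _ _ _)
      (d : LocalArtinData F) (𝓔 : LocalEpsilonSystem F) (hd : 𝓔.artin F = d),
      localLanglands_gl_indecomposable F hmul huniq hn hex hns d 𝓔 hd := by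
  sorry

/-- **Stub F3 (LITERATURE DEBT, on the chain of stmt-Langlands-17925): Henniart 2002, Thm 1.7 (a), Galois
side** — a non-irreducible Frobenius-semisimple parameter is determined by the pole orders of its
`L`-factors against the indecomposable parameters of smaller dimension; the tree's named fact
`Henniart2002_isEquivalent_of_rootMultiplicity_eulerFactor_tprod_eq`. [cite: HenniartBSMF2002, Thm. 1.7 (a)] -/
theorem stub_henniart2002_thm17a :
    ∀ (F : Type) [Field F] [ValuativeRel F] [TopologicalSpace F] [IsNonarchimedeanLocalField F],
      Henniart2002_isEquivalent_of_rootMultiplicity_eulerFactor_tprod_eq F := by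
  sorry

/-! ## §2 R from the stubs: rigidity on generic classes (every rank) and on local components -/

section Classes

variable {K : Type} [Field K] [NumberField K]

/-- **R_gen from the stubs**: two pinned reciprocity data agree on every generic class of every completion,
every rank — `recGL_eq_of_isGeneric_of_namedFacts` (p157386) fed by F1, F2, F3 and the DISCHARGED (Fν)
`stub_exists_smulInvariantMeasure_glQuotUpperUnitriangular` (from p158762).
[cite: HenniartBSMF2002, Thm. 1.5 and Thm. 1.7 (a)] [cite: Henniarts1993, Thm 1.1] -/
theorem recRigidityGeneric_of_stubs (𝓡 𝓡' : ReciprocityData K) (v : HeightOneSpectrum (𝓞 K))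
    (n : ℕ) (πv : SmoothIrrep (GL (Fin n) (v.adicCompletion K)))
    (ψ : AddChar (v.adicCompletion K) Circle) (hψ : ψ.IsContinuousNontrivial)
    (hg : IsGeneric πv.ρ ψ) :
    (𝓡.llc v).recGL n (IrrClass.mk πv) = (𝓡'.llc v).recGL n (IrrClass.mk πv) :=
  PhantomRMJunctionOfPieces.recGL_eq_of_isGeneric_of_namedFacts stub_localLanglands_gl
    stub_localLanglands_gl_indecomposable stub_henniart2002_thm17a
    PhantomRMJunctionOfPieces.stub_exists_smulInvariantMeasure_glQuotUpperUnitriangular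
    K 𝓡 𝓡' v n πv ψ hψ hg

/-- **R from the stubs**: the two data agree on the local components of cuspidal automorphic
representations of `GL_n(𝔸_K)`, `n ≥ 1` (local components of cuspidal `π` are generic:
`CuspidalAutomorphicRepData.exists_isGeneric_of_hasLocalComponentAt`, Shalika 1974). [cite: Shalika1974, Thm 5.5] -/
theorem recRigidityOnLocalComponents_of_stubs (𝓡 𝓡' : ReciprocityData K) (n : ℕ)
    (hcpt : isCompact_glFiniteIntegralLevel n K) (hn : 0 < n)
    (π : CuspidalAutomorphicRepData n K hcpt) (v : HeightOneSpectrum (𝓞 K))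
    (πv : SmoothIrrep (GL (Fin n) (v.adicCompletion K))) (hπv : π.1.HasLocalComponentAt v πv.ρ) :
    (𝓡.llc v).recGL n (IrrClass.mk πv) = (𝓡'.llc v).recGL n (IrrClass.mk πv) := by
  haveI : NeZero n := ⟨hn.ne'⟩
  obtain ⟨ψ, hψ, hg⟩ := π.exists_isGeneric_of_hasLocalComponentAt v πv.ρ πv.isSmooth hπv
  exact recRigidityGeneric_of_stubs 𝓡 𝓡' v n πv ψ hψ hg

end Classes

/-! ## §3 The junction stub and the crux BY NAME -/

/-- **Stub S7 (OPEN CONJECTURE, registered, never delegated): the junction in `∃ 𝓡` form** — global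
Langlands reciprocity for `GL_n` over every number field, for SOME pinned reciprocity datum, granted the
route's sector X (odd, Hodge–Tate-regular `GL₂/ℚ`, direction (B) a.e.).  This is the summit off the sector
(Buzzard–Gee Conj. 3.2.1/3.2.2, Fontaine–Mazur Conj. 1, Taylor Conj. 7–8); in the tree it follows from the
EXISTING items stmt-Langlands-17925 (`ReciprocityUpToIrreducibilityR`) ∧ 13622 ∧ 19093 (Arthur–Clozel
(2.2)/(2.3)) by `PhantomRMJunctionOfR.langlands_of_reciprocityUpToIrreducibilityR_text_of_JS` (p-landed,
13643 chain), X unused. [cite: BuzzardGeeLMS2014, Conj. 3.2.1 and Conj. 3.2.2] [cite: FontaineMazurGeometric1995, Conj. 1] -/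
theorem stub_junctionExists : OddRegularReciprocityQ →
    ∀ (F : Type) [Field F] [NumberField F], ∃ 𝓡 : ReciprocityData F, ∀ n : ℕ, 0 < n →
      ∀ hcpt : isCompact_glFiniteIntegralLevel n F, GlobalLanglandsCorrespondenceGLn n F 𝓡 hcpt := by
  sorry

/-- **The crux BY NAME from the registered stubs** (R from F1/F2/F3 through
`recRigidityOnLocalComponents_of_stubs`, then the landed transfer `sectorComplement_of_rigid_of_junction`
and the junction S7). -/
theorem SectorComplement_of : SectorComplement :=
  sectorComplement_of_rigid_of_junction
    (fun _ _ _ 𝓡 𝓡' n hcpt hn π v πv hπv ↦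
      recRigidityOnLocalComponents_of_stubs 𝓡 𝓡' n hcpt hn π v πv hπv)
    stub_junctionExists

end Summit.Langlands.Langlands.Theorems.ReciprocityRigidity

end
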